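import Literature.Probability.LatticeModels.FKPrimitiveBounds
import Literature.Probability.LatticeModels.SubharmonicGradientBound
import Literature.Probability.LatticeModels.DiscreteCauchyRiemann
import HarnessLib

/-!
# The `L²` bound on the critical FK-Ising observable in the bulk (Smirnov 2010, Lemma 5.3) and its consequences

Topic `Literature/Probability/LatticeModels`; an instalment (item G2 of the road recorded in
`Sweep1Proofs.lean`, module docstring §2b) of the discharge programme for crit-ising.S18 /
Smirnov's Theorem 2.2. S. Smirnov, *Conformal invariance in random cluster models. I*, Ann. of
Math. 172 (2010), Lemma 5.3: on every compact `Q ⊂ Ω`, `δ_j ∑_{z ∈ Q} |F_j(z)|² ≤ C(Q)`; end of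
§5: hence `F_j/√δ_j` is precompact in the local uniform topology. The paper derives Lemma 5.3
from the subharmonicity of `H` by the discrete Riesz representation and a Green-function gradient
bound (Lemma B.4) and quotes the regularity theory of discrete harmonic functions for the
precompactness. Here both are obtained for the tree's objects from the elementary potential
theory of `BoxDirichlet.lean` / `SubharmonicGradientBound.lean`; everything is proved.

* `cornerFlux_add_three_sub_cornerFlux_eq_re` (**Remark 3.7 across black squares**): the
  increment of the primitive between the two black squares at an edge `e_k` is
  `Re(i^k F(e_k)²)/√2`, companion of the tree's `cornerFlux_sub_cornerFlux_eq_im` (white squares,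
  `-Im(i^k F(e_k)²)/√2`); hence `‖F(e)‖⁴ = 2 (white² + black²)` and
  `‖F(e)‖² ≤ √2 (|white| + |black|)` (`norm_sq_le_of_increments`).
* `norm_refPhase` (`= 1`), `fluxConst_eq` (`= κ²`, `κ = cos(π/8)`);
  `norm_sq_fkIsingObservable_le`: for the critical FK-Ising observable at an edge whose
  neighbouring edges are interior, `‖F(e)‖² ≤ (√2/κ²)(|Hw(u+e_k) - Hw(u)| + |Hb(f') - Hb(f)|)` for
  any FK primitive `(Hw, Hb)` (`FKPrimitive.lean`).
* **`sum_norm_sq_fkIsingObservable_le` (Lemma 5.3, lattice form)**: if all edges at the sites of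
  the ball of radius `4m + 2` about the centre of a box of side `4m` are interior, then
  `∑_{ball m} (‖F(x, x+e₀)‖² + ‖F(x, x+e₁)‖²) ≤ 2 (√2/κ²) C m` — from the `L¹` gradient bound for
  `(Hb, Hw)` and `(1 - Hw, 1 - Hb)` (`Hb` subharmonic, `Hw` superharmonic, `Hw ≤ Hb ≤ Hw + 1`,
  `0 ≤ H - H_A ≤ 1` by `FKPrimitiveBounds.lean`). No smallness of the fluxes is used.
* `phasedObservable` (`G = refPhase c₀ · F`, the s-holomorphic normalisation of the tree),
  `crVertex_phasedObservable`, `crFace_phasedObservable`, `isLatticeHarmonicOn_phasedObservable`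
  (the real and imaginary parts of the horizontal and of the vertical edge values of `G` are
  lattice-harmonic in the bulk, `DiscreteCauchyRiemann.lean`).
* **`norm_fkIsingObservable_le_of_bulk`** (sup bound `‖F‖ ≤ C/√p` on the ball of radius `p`,
  `m = 4p`) and **`norm_sub_fkIsingObservable_le_of_bulk`** (Lipschitz bound
  `‖F(x+e_j, ·) - F(x, ·)‖ ≤ C'/(p√p)`): the lattice forms of "`F_δ/√δ` is uniformly bounded and
  equicontinuous on compacts" (with `p ∼ 1/δ`: `|F|/√δ = O(1)`, `|∇(F/√δ)| = O(δ)` per lattice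
  step), from the `L¹` interior estimate and the interior gradient estimate of `BoxDirichlet.lean`
  fed with the `L²` bound by Cauchy–Schwarz.

## References

* S. Smirnov, Ann. of Math. 172 (2010) 1435–1467, Remark 3.7, Lemma 5.3, §5 — bib key `Smirnov2010`.
-/

noncomputable section

namespace Literature.Probability.LatticeModels

open Finset Complex ComplexConjugate

/-! ### Remark 3.7 on black squares -/

/-- **Remark 3.7 across black squares.** At the vertex `u`, across its edge `e_k = cSrc (u, k)`
(from the black square `faceAt u k` to the black square `faceAt u (k + 3)`, through the white
square `u`): `|F(u, k+3)|² - |F(u, k)|² = Re(i^k F(e_k)²)/√2`, the companion of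
`cornerFlux_sub_cornerFlux_eq_im` (increment between the two *white* squares at `e_k`,
`-Im(i^k F(e_k)²)/√2`). s-holomorphicity is used at the corner `(u, k + 3)`, read at its target
`e_k`. [cite: Smirnov2010, Remark 3.7] -/
theorem cornerFlux_add_three_sub_cornerFlux_eq_re (F : MedialVertex → ℂ) (u : Site 2) (k : Fin 4)
    (h₃ : IsSHolAt F (u, k + 3)) :
    cornerFlux F (u, k + 3) - cornerFlux F (u, k) = (I ^ (k : ℕ) * F (cSrc (u, k)) ^ 2).re / Real.sqrt 2 := by
  rw [h₃.cornerFlux_eq]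
  simp only [cornerFlux, cFace]
  rw [cTgt_add_three]
  have hn : (k : ℕ) % 4 = (k : ℕ) := Nat.mod_eq_of_lt k.isLt
  have hn3 : ((k : ℕ) + 3) % 4 = ((k + 3 : Fin 4) : ℕ) := frame_index hn 3
  rw [norm_projLine_cornerLine_sq u u (k + 3) hn3, norm_projLine_cornerLine_sq u u k hn,
    coord_pow_add, one_add_I_pow_three, pow_add]
  set X := F (cSrc (u, k)) with hX
  set h := frameCoord u X * (1 + I) ^ (k : ℕ) with hh
  have hsq : (((2 : ℝ) * 2 ^ (k : ℕ) : ℝ) : ℂ) * (I ^ (k : ℕ) * X ^ 2) = h ^ 2 * (-1 - I) := by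
    have e1 : h ^ 2 = X ^ 2 * (-1 + I) * (2 ^ (k : ℕ) * I ^ (k : ℕ)) := by
      rw [hh, frameCoord, mul_pow, mul_pow, ← map_pow, frameVec_sq, ← pow_mul, mul_comm (k : ℕ) 2,
        pow_mul, one_add_I_sq, mul_pow, map_sub, map_neg, map_one, conj_I, sub_neg_eq_add]
    rw [e1]
    push_cast
    linear_combination ((2 : ℂ) ^ (k : ℕ) * I ^ (k : ℕ) * X ^ 2) * I_sq
  have hre1 := congrArg Complex.re hsq
  rw [re_ofReal_mul] at hre1
  have hre2 : (h ^ 2 * (-1 - I)).re = -(h.re ^ 2 - h.im ^ 2) + 2 * h.re * h.im := by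
    simp [sq]; ring
  have hpos : (0 : ℝ) < 2 * 2 ^ (k : ℕ) := by positivity
  have hre3 : (I ^ (k : ℕ) * X ^ 2).re = (-(h.re ^ 2 - h.im ^ 2) + 2 * h.re * h.im) / (2 * 2 ^ (k : ℕ)) := by
    rw [eq_div_iff hpos.ne', mul_comm, hre1, hre2]
  have hre4 : (h * (-2 + 2 * I)).re = -2 * h.re - 2 * h.im := by simp; ring
  rw [hre3, hre4]
  have hs : (Real.sqrt 2 : ℝ) ≠ 0 := (Real.sqrt_pos.2 two_pos).ne'
  field_simp
  ring

/-- **`|F(e)|⁴ = 2 (white² + black²)`**: the increments of the primitive across the medial vertex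
`e` in the two directions are `Re` and `Im` of `i^k F(e)²/√2`, so the value of `F` at an edge is
controlled by the two increments: `‖F(e)‖² ≤ √2 (|white| + |black|)`. [cite: Smirnov2010, Remark 3.7] -/
theorem norm_sq_le_of_increments (F : MedialVertex → ℂ) (u : Site 2) (k : Fin 4) {W B : ℝ}
    (hW : W = -(I ^ (k : ℕ) * F (cSrc (u, k)) ^ 2).im / Real.sqrt 2)
    (hB : B = (I ^ (k : ℕ) * F (cSrc (u, k)) ^ 2).re / Real.sqrt 2) :
    ‖F (cSrc (u, k))‖ ^ 2 ≤ Real.sqrt 2 * (|W| + |B|) := by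
  set z := I ^ (k : ℕ) * F (cSrc (u, k)) ^ 2 with hz
  have hnz : ‖z‖ = ‖F (cSrc (u, k))‖ ^ 2 := by
    rw [hz, norm_mul, norm_pow, norm_I, one_pow, one_mul, norm_pow]
  have hs : (0 : ℝ) < Real.sqrt 2 := Real.sqrt_pos.2 two_pos
  have hs2 : Real.sqrt 2 ^ 2 = 2 := Real.sq_sqrt zero_le_two
  -- `W² + B² = ‖z‖² / 2`
  have hsum : W ^ 2 + B ^ 2 = ‖z‖ ^ 2 / 2 := by
    rw [hW, hB, div_pow, div_pow, neg_sq, hs2, Complex.sq_norm, Complex.normSq_apply]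
    ring
  -- `‖z‖² ≤ 2 (|W| + |B|)²`, hence `‖z‖ ≤ √2 (|W| + |B|)`
  have h1 : ‖z‖ ^ 2 ≤ (Real.sqrt 2 * (|W| + |B|)) ^ 2 := by
    rw [mul_pow, hs2]
    have : (|W| + |B|) ^ 2 = W ^ 2 + B ^ 2 + 2 * (|W| * |B|) := by
      rw [add_sq, sq_abs, sq_abs]; ring
    rw [this]
    nlinarith [abs_nonneg W, abs_nonneg B, mul_nonneg (abs_nonneg W) (abs_nonneg B)]
  rw [← hnz]
  exact (pow_le_pow_iff_left₀ (norm_nonneg _) (by positivity) two_ne_zero).1 h1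

/-! ### The reference phase has norm one -/

/-- `‖refPhase c₀‖ = 1`. [cite: Smirnov2010, Def. 3.1] -/
theorem norm_refPhase (c₀ : Site 2 × Fin 4) : ‖refPhase c₀‖ = 1 := by
  have h := congrArg (fun w : ℂ => ‖w‖) (refPhase_sq c₀)
  simp only [norm_pow, norm_mul, norm_div, norm_neg, norm_I, one_pow, mul_one, Complex.norm_real,
    Real.norm_eq_abs] at h
  have h2 : ‖(-1 - I : ℂ)‖ = Real.sqrt 2 := by
    rw [Complex.norm_def, Complex.normSq_apply]; norm_num
  rw [h2, abs_of_pos (Real.sqrt_pos.2 two_pos), div_self (Real.sqrt_pos.2 two_pos).ne'] at h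
  have h0 : 0 ≤ ‖refPhase c₀‖ := norm_nonneg _
  nlinarith [h, h0]

/-- `fluxConst c₀ = κ²`, `κ = cos(π/8) = Re e^{-iπ/8}`. [cite: Smirnov2010, Lemma 3.6] -/
theorem fluxConst_eq (c₀ : Site 2 × Fin 4) : fluxConst c₀ = (eighthPhase 1).re ^ 2 := by
  rw [fluxConst, norm_refPhase, one_pow, div_one]

/-- The constant `√2 / κ²` converting increments of the primitive into `|F|²`. [cite: Smirnov2010, Remark 3.7] -/
def obsFluxConst : ℝ := Real.sqrt 2 / (eighthPhase 1).re ^ 2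

/-- `κ² > 0`. [cite: Smirnov2010, §4] -/
theorem kappa_re_sq_pos : 0 < (eighthPhase 1).re ^ 2 := by
  have hkr : ((eighthPhase 1).re : ℝ) ≠ 0 := by
    have := kappa_ne_zero; rw [kappa_eq_re] at this; exact_mod_cast this
  positivity

/-- `√2/κ² > 0`. [cite: Smirnov2010, Remark 3.7] -/
theorem obsFluxConst_pos : 0 < obsFluxConst :=
  div_pos (Real.sqrt_pos.2 two_pos) kappa_re_sq_pos

/-! ### `|F(e)|²` is controlled by the increments of the FK primitive -/

section FK

variable {E : DiscreteDobrushin} [Fintype (meshDomain E.Ω E.δ)] {hE : E.IsZdAdmissible} {Hw Hb : Site 2 → ℝ}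

/-- **`|F(e)|² ≤ (√2/κ²) (|Hw(u + e_k) - Hw(u)| + |Hb(faceAt u (k+3)) - Hb(faceAt u k)|)`** for the
critical FK-Ising observable at an edge `e = cSrc (u, k)` all of whose neighbouring edges
`(u, k + 3)`, `(u + e_k, k + 1)` are interior, together with `e` itself (admissible data with
connected wired arc, any FK primitive `(Hw, Hb)`): the two increments are `κ²` times the
`Im`/`Re` parts of `i^k (refPhase · F(e))²/√2` (Remark 3.7 in both colours).
[cite: Smirnov2010, Remark 3.7 and Lemma 5.3] -/
theorem norm_sq_fkIsingObservable_le (h : IsFKPrimitive E hE Hw Hb)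
    (hA : ((discreteDomainGraph E.Ω E.δ).induce E.zdArcA).Preconnected) {u : Site 2} {k : Fin 4}
    (h0 : E.IsInteriorEdge u k) (h3 : E.IsInteriorEdge u (k + 3)) (h1 : E.IsInteriorEdge (u + cornerUnit k) (k + 1)) :
    ‖fkIsingObservable E criticalFKIsingParam (cSrc (u, k))‖ ^ 2 ≤
      obsFluxConst * (|Hw (u + cornerUnit k) - Hw u| + |Hb (faceAt u (k + 3)) - Hb (faceAt u k)|) := by
  set c₀ := DiscreteDobrushin.startCorner hE with hc₀
  set G : MedialVertex → ℂ := fun z => refPhase c₀ * fkIsingObservable E criticalFKIsingParam z with hG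
  -- the primitive property at the three corners
  have p0 := h (u, k) h0.inner
  have p1 := h (u + cornerUnit k, k + 1) (by
    change E.IsInnerFace (faceAt (u + cornerUnit k) (k + 1)); rw [faceAt_add_unit_succ]; exact h0.inner)
  have p3 := h (u, k + 3) h0.inner'
  simp only [cFace] at p0 p1 p3
  rw [faceAt_add_unit_succ] at p1
  -- the fluxes as rescaled corner fluxes of `G`
  have d0 : dartFlux E hE (u, k) = fluxConst c₀ * cornerFlux G (u, k) := dartFlux_eq_source hE hA h0
  have d1 : dartFlux E hE (u + cornerUnit k, k + 1) = fluxConst c₀ * cornerFlux G (u + cornerUnit k, k + 1) :=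
    dartFlux_eq_source hE hA h1
  have d3 : dartFlux E hE (u, k + 3) = fluxConst c₀ * cornerFlux G (u, k + 3) := dartFlux_eq_source hE hA h3
  -- s-holomorphicity of `G` at the two corners
  have s1 : IsSHolAt G (u + cornerUnit k, k + 1) :=
    isSHolAt_refPhase hE hA h1 (by rw [show k + 1 + 1 = k + 2 by omega]; exact h0.reverse)
  have s3 : IsSHolAt G (u, k + 3) :=
    isSHolAt_refPhase hE hA h3 (by rw [show k + 3 + 1 = k by omega]; exact h0)
  have wI := cornerFlux_sub_cornerFlux_eq_im G u k s1
  have bR := cornerFlux_add_three_sub_cornerFlux_eq_re G u k s3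
  -- the increments of `H`
  set W := -(I ^ (k : ℕ) * G (cSrc (u, k)) ^ 2).im / Real.sqrt 2 with hW
  set B := (I ^ (k : ℕ) * G (cSrc (u, k)) ^ 2).re / Real.sqrt 2 with hB
  have hfc : fluxConst c₀ = (eighthPhase 1).re ^ 2 := fluxConst_eq c₀
  have hwhite : Hw (u + cornerUnit k) - Hw u = (eighthPhase 1).re ^ 2 * W := by
    rw [← wI, ← hfc, mul_sub]; linarith [d0, d1]
  have hblack : Hb (faceAt u (k + 3)) - Hb (faceAt u k) = (eighthPhase 1).re ^ 2 * B := by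
    rw [← bR, ← hfc, mul_sub]; linarith [d0, d3]
  -- `‖G(e)‖² ≤ √2 (|W| + |B|)` and `‖G(e)‖ = ‖F(e)‖`
  have hmain := norm_sq_le_of_increments G u k rfl rfl
  have hGe : ‖G (cSrc (u, k))‖ = ‖fkIsingObservable E criticalFKIsingParam (cSrc (u, k))‖ := by
    simp only [hG, norm_mul, norm_refPhase, one_mul]
  rw [hGe] at hmain
  have hκ := kappa_re_sq_pos
  rw [hwhite, hblack, abs_mul, abs_mul, abs_of_pos hκ, ← mul_add, obsFluxConst]
  have hκ' : (eighthPhase 1).re ^ 2 ≠ 0 := hκ.ne'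
  have hκ'' : (eighthPhase 1).re ≠ 0 := fun h0 => hκ' (by rw [h0]; ring)
  have e : Real.sqrt 2 / (eighthPhase 1).re ^ 2 * ((eighthPhase 1).re ^ 2 * (|W| + |B|)) = Real.sqrt 2 * (|W| + |B|) := by
    field_simp
  rw [e]
  exact hmain

/-! ### Geometry of faces and balls -/

omit [Fintype (meshDomain E.Ω E.δ)] in
/-- `faceAt x 0 = x` (the face of which `x` is the lower-left corner). [folklore] -/
theorem faceAt_zero_eq (x : Site 2) : faceAt x 0 = x := by
  simp [faceAt, show cornerOff 0 = 0 from rfl]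

omit [Fintype (meshDomain E.Ω E.δ)] in
/-- `faceAt x 3 = x + e₃` (the face `x - e₁`, of which `x` is the upper-left corner). [folklore] -/
theorem faceAt_three_eq (x : Site 2) : faceAt x 3 = x + cornerUnit 3 := by
  ext i; fin_cases i <;> simp [faceAt, cornerOff, cornerUnit]; ring

omit [Fintype (meshDomain E.Ω E.δ)] in
/-- `faceAt x 1 = x + e₂` (the face `x - e₀`). [folklore] -/
theorem faceAt_one_eq (x : Site 2) : faceAt x 1 = x + cornerUnit 2 := by
  ext i; fin_cases i <;> simp [faceAt, cornerOff, cornerUnit]; ring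

omit [Fintype (meshDomain E.Ω E.δ)] in
/-- Corners of faces in a ball lie in the next ball. [folklore] -/
theorem add_cornerOff_mem_latticeBall {c x : Site 2} {R : ℤ} (hx : x ∈ latticeBall c R) (j : Fin 4) :
    x + cornerOff j ∈ latticeBall c (R + 1) := by
  rw [mem_latticeBall] at hx ⊢
  intro i
  have h0 := hx 0
  have h1 := hx 1
  fin_cases i <;> fin_cases j <;> simp [cornerOff] <;> constructor <;> linarith

omit [Fintype (meshDomain E.Ω E.δ)] in
/-- Membership in a ball about the centre of the box of side `4m` at `a`, in coordinates. [folklore] -/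
theorem mem_latticeBall_boxCentre {a : Site 2} {m : ℕ} {R : ℤ} {y : Site 2} :
    y ∈ latticeBall (boxCentre a m) R ↔
      (a 0 + 2 * m - R ≤ y 0 ∧ y 0 ≤ a 0 + 2 * m + R) ∧ (a 1 + 2 * m - R ≤ y 1 ∧ y 1 ≤ a 1 + 2 * m + R) := by
  rw [mem_latticeBall, Fin.forall_fin_two]
  simp [boxCentre]

/-! ### The `L²` bound on a box (Lemma 5.3) -/

/-- **Lemma 5.3 (the `L²` bound), lattice form.** Let `(Hw, Hb)` be an FK primitive of admissible
data with connected wired arc and arc-constancy (`hcA`, `hcB`, as in `FKPrimitiveBounds`), and let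
all edges at the sites of the ball of radius `4m + 2` about the centre `c` of the box of side `4m`
at `a` be interior (`m ≥ 4`). Then
`∑_{x ∈ ball(c, m)} (‖F(x, x+e₀)‖² + ‖F(x, x+e₁)‖²) ≤ 2 (√2/κ²) C m`: the sum of `|F|²` over the
medial vertices of a box of side `∼ m` deep inside `Ω_δ` is `O(m)` — Smirnov's `δ ∑ |F_δ|² ≤ C(Q)`.
Proof: `‖F(e)‖²` is bounded by the increments of `Hw` and `Hb` across `e`
(`norm_sq_fkIsingObservable_le`), whose `L¹` norms over the box are `O(m)` by
`sum_abs_sub_le_of_subharmonic_le_superharmonic` applied to `(Hb, Hw)` and to `(1 - Hw, 1 - Hb)`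
(`Hb` subharmonic, `Hw` superharmonic, `Hw ≤ Hb ≤ Hw + 1`, `0 ≤ H - H_A ≤ 1`).
[cite: Smirnov2010, Lemma 5.3] -/
theorem sum_norm_sq_fkIsingObservable_le (h : IsFKPrimitive E hE Hw Hb)
    (hA : ((discreteDomainGraph E.Ω E.δ).induce E.zdArcA).Preconnected)
    (hcA : ∀ a' ∈ E.zdArcA, (∃ k, E.IsInnerFace (faceAt a' k)) → Hw a' = Hw (DiscreteDobrushin.startCorner hE).1)
    (hcB : ∀ b ∈ E.zdArcB, (∃ k, E.IsInnerFace (faceAt b k)) →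
      Hw b = Hw ((DiscreteDobrushin.startCorner hE).1 + cornerUnit (DiscreteDobrushin.startCorner hE).2))
    {a : Site 2} {m : ℕ} (hm : 4 ≤ m)
    (hint : ∀ x ∈ latticeBall (boxCentre a m) (2 * (2 * m) + 2), ∀ k : Fin 4, E.IsInteriorEdge x k) :
    ∑ x ∈ latticeBall (boxCentre a m) m,
      (‖fkIsingObservable E criticalFKIsingParam (cSrc (x, 0))‖ ^ 2 +
        ‖fkIsingObservable E criticalFKIsingParam (cSrc (x, 1))‖ ^ 2) ≤
      2 * obsFluxConst * energyGradConst * m := by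
  set c := boxCentre a m with hc
  set c₀ := DiscreteDobrushin.startCorner hE with hc₀
  set HA := Hw c₀.1 with hHA
  have hjump : Hw (c₀.1 + cornerUnit c₀.2) = HA + 1 := h.jump_startCorner
  have hsub : ∀ {R R' : ℤ}, R ≤ R' → ∀ x ∈ latticeBall c R, x ∈ latticeBall c R' :=
    fun hRR' x hx => latticeBall_subset hRR' hx
  -- interior regions
  have hIS : ∀ x ∈ latticeBall c (2 * (2 * m) + 2), x ∈ E.interiorSites := fun x hx k => hint x hx k
  have hIF : ∀ f ∈ latticeBall c (2 * (2 * m) + 1), f ∈ E.interiorFaces := fun f hf j =>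
    hint _ (add_cornerOff_mem_latticeBall hf j) j
  have hinner : ∀ f ∈ latticeBall c (2 * (2 * m) + 2), E.IsInnerFace f := fun f hf => by
    have := (hint f hf 0).inner; rwa [faceAt_zero_eq] at this
  -- bounds `HA ≤ Hw ≤ Hb ≤ HA + 1` and `Hb ≤ Hw + 1`
  have hHb : ∀ f ∈ latticeBall c (2 * (2 * m) + 2), HA ≤ Hb f ∧ Hb f ≤ HA + 1 := by
    intro f hf
    have := h.hb_mem_Icc hA hcA hcB (hinner f hf)
    rw [hjump] at this
    exact this
  have hHw : ∀ x ∈ latticeBall c (2 * (2 * m) + 2), HA ≤ Hw x ∧ Hw x ≤ HA + 1 := by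
    intro x hx
    have := h.hw_mem_Icc hA hcA hcB (v := x) ⟨0, by rw [faceAt_zero_eq]; exact hinner x hx⟩
    rw [hjump] at this
    exact this
  have hwb : ∀ x ∈ latticeBall c (2 * (2 * m) + 2), Hw x ≤ Hb x ∧ Hb x ≤ Hw x + 1 := by
    intro x hx
    have hf : E.IsInnerFace (faceAt x 0) := by rw [faceAt_zero_eq]; exact hinner x hx
    have h1 := h.hw_le_hb hf
    have h2 := h (x, 0) hf
    simp only [cFace] at h2
    rw [faceAt_zero_eq] at h1 h2
    exact ⟨h1, by linarith [dartFlux_le_one hE (x, 0)]⟩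
  -- sub/superharmonicity
  have hsubHb : IsLatticeSubharmonicOn Hb (latticeBall c (2 * (2 * m)) : Set (Site 2)) := fun f hf =>
    h.subharmonicOn_interiorFaces hA f (hIF f (hsub (by omega) f hf))
  have hsupHw : IsLatticeSuperharmonicOn Hw (latticeBall c (2 * (2 * m)) : Set (Site 2)) := fun x hx =>
    h.superharmonicOn_interiorSites hA x (hIS x (hsub (by omega) x hx))
  have hboxball : ∀ x ∈ boxInterior a (4 * m), x ∈ latticeBall c (2 * (2 * m)) := fun x hx =>
    hsub (by omega) x ((mem_boxInterior_iff_mem_latticeBall (a := a) (m := m)).1 hx)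
  -- (i) gradient of `Hb`
  have hgradHb : ∑ x ∈ latticeBall c m, ∑ k : Fin 4, |Hb (x + cornerUnit k) - Hb x| ≤ energyGradConst * m := by
    have key := sum_abs_sub_le_of_subharmonic_le_superharmonic (a := a) hm (s := fun x => Hb x + (-HA))
      (w := fun x => Hw x + (-HA)) ?_ ?_ ?_ ?_
    · simpa using key
    · intro f hf; rw [latticeLaplacian_add_const]; exact hsubHb f hf
    · intro x hx; have := hHb x (hsub (by omega) x hx); constructor <;> linarith [this.1, this.2]
    · intro x hx; rw [latticeLaplacian_add_const]; exact hsupHw x (hboxball x hx)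
    · intro x hx; have := hwb x (hsub (by omega) x hx); constructor <;> linarith [this.1, this.2]
  -- (ii) gradient of `Hw` (apply the lemma to `HA + 1 - Hw` and `HA + 1 - Hb`)
  have hgradHw : ∑ x ∈ latticeBall c m, ∑ k : Fin 4, |Hw (x + cornerUnit k) - Hw x| ≤ energyGradConst * m := by
    have key := sum_abs_sub_le_of_subharmonic_le_superharmonic (a := a) hm (s := fun x => (-Hw) x + (HA + 1))
      (w := fun x => (-Hb) x + (HA + 1)) ?_ ?_ ?_ ?_
    · simp only [Pi.neg_apply] at key
      refine le_trans (le_of_eq (Finset.sum_congr rfl fun x _ => Finset.sum_congr rfl fun k _ => ?_)) key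
      rw [show -Hw (x + cornerUnit k) + (HA + 1) - (-Hw x + (HA + 1)) = -(Hw (x + cornerUnit k) - Hw x) by ring, abs_neg]
    · intro x hx; rw [latticeLaplacian_add_const, latticeLaplacian_neg]; linarith [hsupHw x hx]
    · intro x hx; have := hHw x (hsub (by omega) x hx); simp only [Pi.neg_apply]; constructor <;> linarith [this.1, this.2]
    · intro f hf; rw [latticeLaplacian_add_const, latticeLaplacian_neg]; linarith [hsubHb f (hboxball f hf)]
    · intro x hx; have := hwb x (hsub (by omega) x hx); simp only [Pi.neg_apply]; constructor <;> linarith [this.1, this.2]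
  -- (iii) the per-site bound
  have hsite : ∀ x ∈ latticeBall c m,
      ‖fkIsingObservable E criticalFKIsingParam (cSrc (x, 0))‖ ^ 2 +
        ‖fkIsingObservable E criticalFKIsingParam (cSrc (x, 1))‖ ^ 2 ≤
      obsFluxConst * ((|Hw (x + cornerUnit 0) - Hw x| + |Hb (x + cornerUnit 3) - Hb x|) +
        (|Hw (x + cornerUnit 1) - Hw x| + |Hb (x + cornerUnit 2) - Hb x|)) := by
    intro x hx
    have hx2 : x ∈ latticeBall c (2 * (2 * m) + 2) := hsub (by omega) x hx
    have hx1 : ∀ k : Fin 4, x + cornerUnit k ∈ latticeBall c (2 * (2 * m) + 2) := fun k => by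
      have := add_cornerUnit_mem_latticeBall hx k; exact hsub (by omega) _ this
    have b0 := norm_sq_fkIsingObservable_le h hA (u := x) (k := 0) (hint x hx2 0) (hint x hx2 (0 + 3)) (hint _ (hx1 0) (0 + 1))
    have b1 := norm_sq_fkIsingObservable_le h hA (u := x) (k := 1) (hint x hx2 1) (hint x hx2 (1 + 3)) (hint _ (hx1 1) (1 + 1))
    rw [show (0 : Fin 4) + 3 = 3 from rfl, faceAt_three_eq, faceAt_zero_eq] at b0
    rw [show (1 : Fin 4) + 3 = 0 from rfl, faceAt_zero_eq, faceAt_one_eq] at b1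
    rw [abs_sub_comm (Hb x) (Hb (x + cornerUnit 2))] at b1
    rw [mul_add]
    exact add_le_add b0 b1
  -- (iv) assemble: the four increments at `x` are among the eight `∑_k (|∇Hw| + |∇Hb|)`
  have hC := obsFluxConst_pos
  calc _ ≤ ∑ x ∈ latticeBall c m, obsFluxConst * ((|Hw (x + cornerUnit 0) - Hw x| + |Hb (x + cornerUnit 3) - Hb x|) +
          (|Hw (x + cornerUnit 1) - Hw x| + |Hb (x + cornerUnit 2) - Hb x|)) := Finset.sum_le_sum hsite
    _ ≤ ∑ x ∈ latticeBall c m, obsFluxConst * ((∑ k : Fin 4, |Hw (x + cornerUnit k) - Hw x|) +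
          ∑ k : Fin 4, |Hb (x + cornerUnit k) - Hb x|) := by
        refine Finset.sum_le_sum fun x _ => mul_le_mul_of_nonneg_left ?_ hC.le
        rw [Fin.sum_univ_four, Fin.sum_univ_four]
        have t1 := abs_nonneg (Hw (x + cornerUnit 2) - Hw x)
        have t2 := abs_nonneg (Hw (x + cornerUnit 3) - Hw x)
        have t3 := abs_nonneg (Hb (x + cornerUnit 0) - Hb x)
        have t4 := abs_nonneg (Hb (x + cornerUnit 1) - Hb x)
        linarith
    _ = obsFluxConst * ((∑ x ∈ latticeBall c m, ∑ k : Fin 4, |Hw (x + cornerUnit k) - Hw x|) +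
          ∑ x ∈ latticeBall c m, ∑ k : Fin 4, |Hb (x + cornerUnit k) - Hb x|) := by
        rw [← Finset.sum_add_distrib, Finset.mul_sum]
    _ ≤ obsFluxConst * (energyGradConst * m + energyGradConst * m) := by
        refine mul_le_mul_of_nonneg_left (add_le_add hgradHw hgradHb) hC.le
    _ = 2 * obsFluxConst * energyGradConst * m := by ring

/-! ### Harmonicity of the phased observable on the two sublattices, in the bulk -/

/-- The **phased observable** `G = refPhase c₀ · F`: H21's `cornerLine` frame is `refPhase c₀`
times Smirnov's, so `G` is the function that is s-holomorphic in the tree's sense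
(`isSHolAt_refPhase`); `‖G‖ = ‖F‖` (`norm_refPhase`). [cite: Smirnov2010, Def. 3.1 and Lemma 4.5] -/
def phasedObservable (E : DiscreteDobrushin) [Fintype (meshDomain E.Ω E.δ)] (hE : E.IsZdAdmissible)
    (z : MedialVertex) : ℂ :=
  refPhase (DiscreteDobrushin.startCorner hE) * fkIsingObservable E criticalFKIsingParam z

/-- `‖G(z)‖ = ‖F(z)‖`. [cite: Smirnov2010, Def. 3.1] -/
theorem norm_phasedObservable (hE : E.IsZdAdmissible) (z : MedialVertex) :
    ‖phasedObservable E hE z‖ = ‖fkIsingObservable E criticalFKIsingParam z‖ := by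
  rw [phasedObservable, norm_mul, norm_refPhase, one_mul]

/-- **Cauchy–Riemann at a vertex all of whose edges are interior.** [cite: Smirnov2010, Remark 3.3 with Lemma 4.5] -/
theorem crVertex_phasedObservable (hA : ((discreteDomainGraph E.Ω E.δ).induce E.zdArcA).Preconnected)
    {v : Site 2} (hv : ∀ k : Fin 4, E.IsInteriorEdge v k) : CRVertex (phasedObservable E hE) v :=
  crVertex_of_isSHolAt fun k => isSHolAt_refPhase hE hA (hv k) (hv (k + 1))

/-- **Cauchy–Riemann at a face all of whose corners have interior edges.** [cite: Smirnov2010, Remark 3.3 with Lemma 4.5] -/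
theorem crFace_phasedObservable (hA : ((discreteDomainGraph E.Ω E.δ).induce E.zdArcA).Preconnected)
    {f : Site 2} (hf : ∀ j k : Fin 4, E.IsInteriorEdge (f + cornerOff j) k) : CRFace (phasedObservable E hE) f :=
  crFace_of_isSHolAt fun j => isSHolAt_refPhase hE hA (hf j j) (hf j (j + 1))

/-- **The five-point identity on both sublattices, in the bulk**: if all edges at all sites of the
ball of radius `2` about `v` are interior, then `∑_k G_i(v + e_k) - 4 G_i(v) = 0` for the horizontal
(`i = 0`) and vertical (`i = 1`) edge functions of the phased observable.
[cite: Smirnov2010, Remark 3.3] -/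
theorem sum_edgeFun_phasedObservable_sub (hA : ((discreteDomainGraph E.Ω E.δ).induce E.zdArcA).Preconnected)
    {v : Site 2} (hv : ∀ y ∈ latticeBall v 2, ∀ k : Fin 4, E.IsInteriorEdge y k) :
    ((∑ k : Fin 4, edgeFun (phasedObservable E hE) 0 (v + cornerUnit k)) - 4 * edgeFun (phasedObservable E hE) 0 v = 0) ∧
    ((∑ k : Fin 4, edgeFun (phasedObservable E hE) 1 (v + cornerUnit k)) - 4 * edgeFun (phasedObservable E hE) 1 v = 0) := by
  have hv0 : v ∈ latticeBall v 0 := by rw [mem_latticeBall]; intro i; constructor <;> linarith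
  have hV : ∀ y ∈ latticeBall v 2, CRVertex (phasedObservable E hE) y := fun y hy => crVertex_phasedObservable hA (hv y hy)
  have hF : ∀ f ∈ latticeBall v 1, CRFace (phasedObservable E hE) f := fun f hf =>
    crFace_phasedObservable hA fun j k => hv _ (by
      have := add_cornerOff_mem_latticeBall hf j; norm_num at this; exact this) k
  have m1 : ∀ k : Fin 4, v + cornerUnit k ∈ latticeBall v 2 := fun k =>
    latticeBall_subset (by norm_num) (add_cornerUnit_mem_latticeBall hv0 k)
  have m2 : ∀ k : Fin 4, v - cornerUnit k ∈ latticeBall v 1 := fun k => by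
    have := add_cornerUnit_mem_latticeBall hv0 (k + 2)
    rw [cornerUnit_add_two, ← sub_eq_add_neg] at this
    norm_num at this; exact this
  have hvv : v ∈ latticeBall v 2 := latticeBall_subset (by norm_num) hv0
  have hv1 : v ∈ latticeBall v 1 := latticeBall_subset (by norm_num) hv0
  exact ⟨sum_edgeFun_zero_sub (hV v hvv) (hV _ (m1 0)) (hF v hv1) (hF _ (m2 1)),
    sum_edgeFun_one_sub (hV v hvv) (hV _ (m1 1)) (hF v hv1) (hF _ (m2 0))⟩

/-- **The real and imaginary parts of the two edge functions are lattice-harmonic** on every ball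
about whose points the edges within distance `2` are interior. [cite: Smirnov2010, Remark 3.3] -/
theorem isLatticeHarmonicOn_phasedObservable (hA : ((discreteDomainGraph E.Ω E.δ).induce E.zdArcA).Preconnected)
    {c : Site 2} {R : ℤ} (hint : ∀ y ∈ latticeBall c (R + 2), ∀ k : Fin 4, E.IsInteriorEdge y k) (i : Fin 4)
    (hi : i = 0 ∨ i = 1) :
    IsLatticeHarmonicOn (fun u => (edgeFun (phasedObservable E hE) i u).re) (latticeBall c R : Set (Site 2)) ∧
    IsLatticeHarmonicOn (fun u => (edgeFun (phasedObservable E hE) i u).im) (latticeBall c R : Set (Site 2)) := by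
  have key : ∀ v ∈ latticeBall c R, (∑ k : Fin 4, edgeFun (phasedObservable E hE) i (v + cornerUnit k)) -
      4 * edgeFun (phasedObservable E hE) i v = 0 := by
    intro v hv
    have hv2 : ∀ y ∈ latticeBall v 2, ∀ k : Fin 4, E.IsInteriorEdge y k := by
      intro y hy k
      refine hint y ?_ k
      rw [mem_latticeBall] at hv hy ⊢
      intro j; have := hv j; have := hy j; constructor <;> linarith
    rcases hi with rfl | rfl
    · exact (sum_edgeFun_phasedObservable_sub hA hv2).1
    · exact (sum_edgeFun_phasedObservable_sub hA hv2).2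
  exact ⟨fun v hv => (latticeLaplacian_re_im_eq_zero (key v hv)).1, fun v hv => (latticeLaplacian_re_im_eq_zero (key v hv)).2⟩

/-! ### Sup and Lipschitz bounds in the bulk -/

/-- The constant of the sup bound. [cite: Smirnov2010, Lemma 5.3 and end of §5] -/
def obsSupConst : ℝ := 2 * (48 * geomConst * Real.sqrt (8 * obsFluxConst * energyGradConst))

/-- `obsSupConst > 0`. [cite: Smirnov2010, §5] -/
theorem obsSupConst_pos : 0 < obsSupConst := by
  unfold obsSupConst
  have := geomConst_pos; have := obsFluxConst_pos; have := energyGradConst_pos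
  positivity

omit [Fintype (meshDomain E.Ω E.δ)] in
/-- `(Re z)² ≤ ‖z‖²` and `(Im z)² ≤ ‖z‖²`. [folklore] -/
theorem re_sq_le_norm_sq (z : ℂ) : z.re ^ 2 ≤ ‖z‖ ^ 2 ∧ z.im ^ 2 ≤ ‖z‖ ^ 2 := by
  constructor
  · have := pow_le_pow_left₀ (abs_nonneg _) (abs_re_le_norm z) 2; rwa [sq_abs] at this
  · have := pow_le_pow_left₀ (abs_nonneg _) (abs_im_le_norm z) 2; rwa [sq_abs] at this

omit [Fintype (meshDomain E.Ω E.δ)] in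
/-- `‖z‖ ≤ |Re z| + |Im z|`. [folklore] -/
theorem norm_le_abs_re_add_abs_im' (z : ℂ) : ‖z‖ ≤ |z.re| + |z.im| := Complex.norm_le_abs_re_add_abs_im z

/-- **Sup bound in the bulk**: with `m = 4p`, `p ≥ 8`, under the hypotheses of the `L²` bound on the
box of side `4m`, `‖F(e)‖ ≤ C / √p` for every horizontal or vertical edge `e = cSrc (x, i)` at a
site `x` of the ball of radius `p` about the centre (the `L¹` interior estimate of
`BoxDirichlet.lean` for the harmonic functions `Re/Im G_i`, fed with the `L²` bound by
Cauchy–Schwarz) — the lattice form of "`F_δ/√δ` is uniformly bounded on compacts".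
[cite: Smirnov2010, Lemma 5.3 and end of §5] -/
theorem norm_fkIsingObservable_le_of_bulk (h : IsFKPrimitive E hE Hw Hb)
    (hA : ((discreteDomainGraph E.Ω E.δ).induce E.zdArcA).Preconnected)
    (hcA : ∀ a' ∈ E.zdArcA, (∃ k, E.IsInnerFace (faceAt a' k)) → Hw a' = Hw (DiscreteDobrushin.startCorner hE).1)
    (hcB : ∀ b ∈ E.zdArcB, (∃ k, E.IsInnerFace (faceAt b k)) →
      Hw b = Hw ((DiscreteDobrushin.startCorner hE).1 + cornerUnit (DiscreteDobrushin.startCorner hE).2))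
    {a : Site 2} {p : ℕ} (hp : 8 ≤ p)
    (hint : ∀ x ∈ latticeBall (boxCentre a (4 * p)) (2 * (2 * (4 * p)) + 2), ∀ k : Fin 4, E.IsInteriorEdge x k)
    {x : Site 2} (hx : x ∈ latticeBall (boxCentre a (4 * p)) p) {i : Fin 4} (hi : i = 0 ∨ i = 1) :
    ‖fkIsingObservable E criticalFKIsingParam (cSrc (x, i))‖ ≤ obsSupConst / Real.sqrt p := by
  set m := 4 * p with hm
  set c := boxCentre a m with hc
  have hm4 : 4 ≤ m := by omega
  have hp0 : 0 < p := by omega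
  have hpr : (0 : ℝ) < p := by exact_mod_cast hp0
  have hmr : (m : ℝ) = 4 * p := by rw [hm]; push_cast; ring
  -- the `L²` bound on the ball of radius `m`
  have hL2 := sum_norm_sq_fkIsingObservable_le h hA hcA hcB hm4 hint
  -- harmonicity on the ball of radius `2 * (2 * m)`
  have hharm := isLatticeHarmonicOn_phasedObservable (hE := hE) hA (c := c) (R := 2 * (2 * m)) hint i hi
  set G := phasedObservable E hE with hG
  have hsub : ∀ {R R' : ℤ}, R ≤ R' → ∀ y ∈ latticeBall c R, y ∈ latticeBall c R' :=
    fun hRR' y hy => latticeBall_subset hRR' hy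
  have hxc := (mem_latticeBall_boxCentre (a := a) (m := m) (R := p) (y := x)).1 hx
  have hboxes : ∀ n ∈ Ico p (2 * p), boxInterior (cornerOf x n) (2 * n) ⊆ (latticeBall c (2 * (2 * m)) : Set (Site 2)) := by
    intro n hn y hy
    have hn2 := (Finset.mem_Ico.1 hn).2
    obtain ⟨k0, k0', k1, k1'⟩ := hy
    simp only [cornerOf, Matrix.cons_val_zero, Matrix.cons_val_one] at k0 k0' k1 k1'
    push_cast at k0' k1'
    show y ∈ latticeBall c (2 * (2 * m))
    rw [hc, mem_latticeBall_boxCentre]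
    omega
  have hsides : ∀ n ∈ Ico p (2 * p), ∀ j ∈ Ico 1 (2 * n),
      (![x 0 - n + j, x 1 + n] : Site 2) ∈ latticeBall c m ∧ (![x 0 - n + j, x 1 - n] : Site 2) ∈ latticeBall c m ∧
      (![x 0 - n, x 1 - n + j] : Site 2) ∈ latticeBall c m ∧ (![x 0 + n, x 1 - n + j] : Site 2) ∈ latticeBall c m := by
    intro n hn j hj
    have hn2 := (Finset.mem_Ico.1 hn).2
    have hj1 := (Finset.mem_Ico.1 hj).1
    have hj2 := (Finset.mem_Ico.1 hj).2
    simp only [hc, mem_latticeBall_boxCentre, Matrix.cons_val_zero, Matrix.cons_val_one]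
    omega
  have hest : ∀ g : Site 2 → ℝ, IsLatticeHarmonicOn g (latticeBall c (2 * (2 * m)) : Set (Site 2)) →
      (p : ℝ) * |g x| ≤ 4 * geomConst / p * ∑ y ∈ latticeBall c m, |g y| := by
    intro g hg
    have := sub_mul_abs_le_sum (x := x) (n₁ := p) (n₂ := 2 * p) hp (h := g)
      (fun n hn => fun y hy => hg y (hboxes n hn hy)) (latticeBall c m) (fun n hn j hj => hsides n hn j hj)
    rw [show 2 * p - p = p by omega] at this
    exact this
  -- Cauchy–Schwarz
  have hcard : ((latticeBall c m).card : ℝ) = (2 * m + 1) ^ 2 := by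
    rw [latticeBall, Fintype.card_piFinset, Fin.prod_univ_two, Int.card_Icc, Int.card_Icc]
    have e1 : (c 0 + (m : ℤ) + 1 - (c 0 - m)).toNat = 2 * m + 1 := by omega
    have e2 : (c 1 + (m : ℤ) + 1 - (c 1 - m)).toNat = 2 * m + 1 := by omega
    rw [e1, e2]; push_cast; ring
  have hsumF : ∑ y ∈ latticeBall c m, ‖fkIsingObservable E criticalFKIsingParam (cSrc (y, i))‖ ^ 2 ≤
      2 * obsFluxConst * energyGradConst * m := by
    refine le_trans (Finset.sum_le_sum fun y _ => ?_) hL2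
    rcases hi with rfl | rfl
    · exact le_add_of_nonneg_right (sq_nonneg _)
    · exact le_add_of_nonneg_left (sq_nonneg _)
  set D : ℝ := Real.sqrt (8 * obsFluxConst * energyGradConst) with hD
  have hD0 : 0 ≤ D := Real.sqrt_nonneg _
  have hD2 : D ^ 2 = 8 * obsFluxConst * energyGradConst := Real.sq_sqrt (by
    have := obsFluxConst_pos; have := energyGradConst_pos; positivity)
  have hsp : Real.sqrt p ^ 2 = p := Real.sq_sqrt hpr.le
  have hsp0 : 0 < Real.sqrt p := Real.sqrt_pos.2 hpr
  -- `∑ |g| ≤ 12 p · D · √p` for `g = Re G_i, Im G_i`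
  have hS : ∀ g : Site 2 → ℝ, (∀ y, g y ^ 2 ≤ ‖fkIsingObservable E criticalFKIsingParam (cSrc (y, i))‖ ^ 2) →
      ∑ y ∈ latticeBall c m, |g y| ≤ 12 * p * (D * Real.sqrt p) := by
    intro g hg
    have cs := Finset.sum_mul_sq_le_sq_mul_sq (latticeBall c m) (fun y => |g y|) (fun _ => (1 : ℝ))
    simp only [mul_one, one_pow, Finset.sum_const, nsmul_eq_mul, mul_one, hcard, sq_abs] at cs
    have h1 : (∑ y ∈ latticeBall c m, |g y|) ^ 2 ≤ (12 * p * (D * Real.sqrt p)) ^ 2 := by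
      calc (∑ y ∈ latticeBall c m, |g y|) ^ 2 ≤ (∑ y ∈ latticeBall c m, g y ^ 2) * (2 * m + 1) ^ 2 := cs
        _ ≤ (2 * obsFluxConst * energyGradConst * m) * (2 * m + 1) ^ 2 :=
            mul_le_mul_of_nonneg_right ((Finset.sum_le_sum fun y _ => hg y).trans hsumF) (by positivity)
        _ ≤ (12 * p * (D * Real.sqrt p)) ^ 2 := by
            rw [mul_pow, mul_pow, mul_pow, hD2, hsp, hmr]
            have hp1 : (1 : ℝ) ≤ p := Nat.one_le_cast.2 hp0
            have key : (2 * (4 * (p : ℝ)) + 1) ^ 2 ≤ 81 * p ^ 2 := by nlinarith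
            have hc1 := obsFluxConst_pos; have hc2 := energyGradConst_pos
            have hX : 0 ≤ obsFluxConst * energyGradConst * p := by positivity
            calc 2 * obsFluxConst * energyGradConst * (4 * (p : ℝ)) * (2 * (4 * (p : ℝ)) + 1) ^ 2
                = (8 * (obsFluxConst * energyGradConst * p)) * (2 * (4 * (p : ℝ)) + 1) ^ 2 := by ring
              _ ≤ (8 * (obsFluxConst * energyGradConst * p)) * (81 * p ^ 2) :=
                  mul_le_mul_of_nonneg_left key (by positivity)
              _ ≤ 12 ^ 2 * (p : ℝ) ^ 2 * (8 * obsFluxConst * energyGradConst * p) := by nlinarith [hX]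
    have hnn : 0 ≤ ∑ y ∈ latticeBall c m, |g y| := Finset.sum_nonneg fun y _ => abs_nonneg _
    exact (pow_le_pow_iff_left₀ hnn (by positivity) two_ne_zero).1 h1
  -- conclude for `Re` and `Im`
  have hbound : ∀ g : Site 2 → ℝ, IsLatticeHarmonicOn g (latticeBall c (2 * (2 * m)) : Set (Site 2)) →
      (∀ y, g y ^ 2 ≤ ‖fkIsingObservable E criticalFKIsingParam (cSrc (y, i))‖ ^ 2) →
      |g x| ≤ 48 * geomConst * D / Real.sqrt p := by
    intro g hg hg2
    have e1 := hest g hg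
    have e2 := hS g hg2
    have hg0 := geomConst_pos
    have e3 : (p : ℝ) * |g x| ≤ 4 * geomConst / p * (12 * p * (D * Real.sqrt p)) :=
      e1.trans (mul_le_mul_of_nonneg_left e2 (by positivity))
    rw [le_div_iff₀ hsp0]
    have e4 : 4 * geomConst / p * (12 * p * (D * Real.sqrt p)) = 48 * geomConst * D * Real.sqrt p := by
      field_simp; ring
    rw [e4] at e3
    -- `p |g x| ≤ 48 C_g D √p` ⇒ `|g x| √p ≤ 48 C_g D` (divide by `√p`, `p = √p²`)
    have e5 : |g x| * Real.sqrt p * Real.sqrt p ≤ 48 * geomConst * D * Real.sqrt p := by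
      rw [mul_assoc, ← sq, hsp, mul_comm]; exact e3
    exact le_of_mul_le_mul_right e5 hsp0
  have hre := hbound (fun u => (edgeFun G i u).re) hharm.1 fun y => by
    have := (re_sq_le_norm_sq (edgeFun G i y)).1; rwa [show ‖edgeFun G i y‖ = _ from norm_phasedObservable hE _] at this
  have him := hbound (fun u => (edgeFun G i u).im) hharm.2 fun y => by
    have := (re_sq_le_norm_sq (edgeFun G i y)).2; rwa [show ‖edgeFun G i y‖ = _ from norm_phasedObservable hE _] at this
  calc ‖fkIsingObservable E criticalFKIsingParam (cSrc (x, i))‖ = ‖edgeFun G i x‖ := (norm_phasedObservable hE _).symm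
    _ ≤ |(edgeFun G i x).re| + |(edgeFun G i x).im| := norm_le_abs_re_add_abs_im' _
    _ ≤ 48 * geomConst * D / Real.sqrt p + 48 * geomConst * D / Real.sqrt p := add_le_add hre him
    _ = obsSupConst / Real.sqrt p := by rw [obsSupConst, hD]; ring

/-- **Lipschitz bound in the bulk**: with `m = 8q`, `q ≥ 8`, under the hypotheses of the `L²`
bound on the box of side `4m`, `‖F(x + e_j, ·) - F(x, ·)‖ ≤ C / (q √q)` for the horizontal or
vertical edge functions at sites `x` of the ball of radius `q` about the centre (interior gradient
estimate for the harmonic functions `Re/Im G_i` with the sup bound on the ball of radius `2q`) —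
the lattice form of the equicontinuity of `F_δ/√δ`. [cite: Smirnov2010, end of §5 (precompactness)] -/
theorem norm_sub_fkIsingObservable_le_of_bulk (h : IsFKPrimitive E hE Hw Hb)
    (hA : ((discreteDomainGraph E.Ω E.δ).induce E.zdArcA).Preconnected)
    (hcA : ∀ a' ∈ E.zdArcA, (∃ k, E.IsInnerFace (faceAt a' k)) → Hw a' = Hw (DiscreteDobrushin.startCorner hE).1)
    (hcB : ∀ b ∈ E.zdArcB, (∃ k, E.IsInnerFace (faceAt b k)) →
      Hw b = Hw ((DiscreteDobrushin.startCorner hE).1 + cornerUnit (DiscreteDobrushin.startCorner hE).2))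
    {a : Site 2} {q : ℕ} (hq : 8 ≤ q)
    (hint : ∀ x ∈ latticeBall (boxCentre a (4 * (2 * q))) (2 * (2 * (4 * (2 * q))) + 2), ∀ k : Fin 4, E.IsInteriorEdge x k)
    {x : Site 2} (hx : x ∈ latticeBall (boxCentre a (4 * (2 * q))) q) {i : Fin 4} (hi : i = 0 ∨ i = 1) (j : Fin 4) :
    ‖fkIsingObservable E criticalFKIsingParam (cSrc (x + cornerUnit j, i)) -
        fkIsingObservable E criticalFKIsingParam (cSrc (x, i))‖ ≤
      8 * topGradConst * obsSupConst / ((2 * q : ℕ) * Real.sqrt (2 * q : ℕ)) := by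
  set p := 2 * q with hp
  set m := 4 * p with hm
  set c := boxCentre a m with hc
  have hp8 : 8 ≤ p := by omega
  have hqr : (0 : ℝ) < q := by exact_mod_cast (show 0 < q by omega)
  have hpr : (0 : ℝ) < (p : ℕ) := by exact_mod_cast (show 0 < p by omega)
  set G := phasedObservable E hE with hG
  set M : ℝ := obsSupConst / Real.sqrt p with hM
  have hM0 : 0 ≤ M := div_nonneg obsSupConst_pos.le (Real.sqrt_nonneg _)
  -- sup bound on the ball of radius `p = 2q`
  have hsup : ∀ y ∈ latticeBall c p, ‖edgeFun G i y‖ ≤ M := fun y hy => by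
    rw [show ‖edgeFun G i y‖ = _ from norm_phasedObservable hE _]
    exact norm_fkIsingObservable_le_of_bulk h hA hcA hcB hp8 hint hy hi
  -- harmonicity on the big ball
  have hharm := isLatticeHarmonicOn_phasedObservable (hE := hE) hA (c := c) (R := 2 * (2 * m)) hint i hi
  -- the box of radius `q` about `x`
  have hN : 16 ≤ 2 * q := by omega
  have hxM : x ∈ boxMiddle (cornerOf x q) (2 * q) := mem_boxMiddle_cornerOf x q
  have hxc := (mem_latticeBall_boxCentre (a := a) (m := m) (R := q) (y := x)).1 hx
  have hboxsub : boxInterior (cornerOf x q) (2 * q) ⊆ (latticeBall c (2 * (2 * m)) : Set (Site 2)) := by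
    intro y hy
    obtain ⟨k0, k0', k1, k1'⟩ := hy
    simp only [cornerOf, Matrix.cons_val_zero, Matrix.cons_val_one] at k0 k0' k1 k1'
    push_cast at k0' k1'
    show y ∈ latticeBall c (2 * (2 * m))
    rw [hc, mem_latticeBall_boxCentre]
    omega
  have hsidesM : ∀ g : Site 2 → ℝ, (∀ y ∈ latticeBall c p, |g y| ≤ M) → ∀ i' : ℕ, 0 < i' → i' < 2 * q →
      |g ![cornerOf x q 0 + i', cornerOf x q 1 + (2 * q : ℕ)]| ≤ M ∧ |g ![cornerOf x q 0 + i', cornerOf x q 1]| ≤ M ∧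
      |g ![cornerOf x q 0, cornerOf x q 1 + i']| ≤ M ∧ |g ![cornerOf x q 0 + (2 * q : ℕ), cornerOf x q 1 + i']| ≤ M := by
    intro g hg i' hi' hi'q
    refine ⟨hg _ ?_, hg _ ?_, hg _ ?_, hg _ ?_⟩
    all_goals
      simp only [hc, mem_latticeBall_boxCentre, cornerOf, Matrix.cons_val_zero, Matrix.cons_val_one]
      push_cast
      omega
  have hgrad : ∀ g : Site 2 → ℝ, IsLatticeHarmonicOn g (latticeBall c (2 * (2 * m)) : Set (Site 2)) →
      (∀ y ∈ latticeBall c p, |g y| ≤ M) → |g (x + cornerUnit j) - g x| ≤ 4 * topGradConst * M / (2 * q : ℕ) := by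
    intro g hg hgM
    exact harmonic_box_gradient_le (cornerOf x q) (2 * q) hN (fun y hy => hg y (hboxsub hy)) hM0
      (hsidesM g hgM) hxM j
  have hre := hgrad (fun u => (edgeFun G i u).re) hharm.1 fun y hy =>
    (abs_re_le_norm _).trans (hsup y hy)
  have him := hgrad (fun u => (edgeFun G i u).im) hharm.2 fun y hy =>
    (abs_im_le_norm _).trans (hsup y hy)
  have hsq0 : 0 < Real.sqrt (p : ℕ) := Real.sqrt_pos.2 hpr
  calc ‖fkIsingObservable E criticalFKIsingParam (cSrc (x + cornerUnit j, i)) -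
          fkIsingObservable E criticalFKIsingParam (cSrc (x, i))‖
      = ‖edgeFun G i (x + cornerUnit j) - edgeFun G i x‖ := by
        rw [edgeFun, edgeFun, hG, phasedObservable, phasedObservable, ← mul_sub, norm_mul, norm_refPhase, one_mul]
    _ ≤ |(edgeFun G i (x + cornerUnit j) - edgeFun G i x).re| + |(edgeFun G i (x + cornerUnit j) - edgeFun G i x).im| :=
        norm_le_abs_re_add_abs_im' _
    _ ≤ 4 * topGradConst * M / (2 * q : ℕ) + 4 * topGradConst * M / (2 * q : ℕ) := by
        rw [sub_re, sub_im]; exact add_le_add hre him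
    _ = 8 * topGradConst * obsSupConst / ((2 * q : ℕ) * Real.sqrt (2 * q : ℕ)) := by
        rw [hM, hp]; field_simp; ring

end FK

end Literature.Probability.LatticeModels
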